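/-
Copyright (c) 2026 the pub-hodgecm-mathlib formalisation cell (harness21).  Prover seat hodgecm-mathlib-K2-defs1 (g5), Track B ∕ K2-LIT,
h413 = `stmt-HodgeConjecture-24833`, line `K2_E1_TraceFormulaBeta`, «R7₃-SCALAR» (q10) FILE 3 input «ADELIC-BASIS-TRANSPORT» (K2E2-p12 (g5) 2026-09-04T08:05:36Z «=»):
a `K`-basis of `L` makes `𝔸_{L,f}` the product `(𝔸_{K,f})^ι` — as a topological group, for Haar measure, and place by place.
-/
import Literature.NumberTheory.AdelicBaseChange.NumberFieldAdeleBaseChange   -- ★ FLT packet file 15: scoped `Algebra 𝔸ᶠ[K] 𝔸ᶠ[L]`, `ComapFiberwiseSMul`, `IsModuleTopology 𝔸ᶠ[K] 𝔸ᶠ[L]`, `IsModuleTopology.continuousLinearEquiv`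
import Literature.NumberTheory.AdelicBaseChange.AdeleNormTrace                 -- ★ `finiteAdeleRingTensorAlgEquiv : 𝔸ᶠ[K] ⊗[K] L ≃ₐ[𝔸ᶠ[K]] 𝔸ᶠ[L]`, `_one_tmul`
import Literature.NumberTheory.AdelicBaseChange.AutomorphicCompat              -- ★ FLT's `mapSemialgHom` = the tree's `FiniteAdeleRing.baseChange` (`finiteAdeleRing_mapSemialgHom_apply_eq_baseChange`)
import Literature.NumberTheory.Automorphic.AdeleBaseChange                     -- ★ the tree's `FiniteAdeleRing.baseChange (𝓞 K) K L (𝓞 L)`, `_apply`, `_algebraMap`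
import Literature.NumberTheory.Automorphic.AdelicSecondCountable               -- ★ `secondCountableTopology_finiteAdeleRing` (Borel structure on `ι → 𝔸ᶠ[K]`)
import Literature.NumberTheory.Automorphic.AdicCompletionCompact               -- ★ `locallyCompactSpace_finiteAdeleRing'` (Haar uniqueness on `𝔸ᶠ[L]`)
import Literature.NumberTheory.Automorphic.UnitaryGroupSymplecticCarriers         -- ★ `UnitaryGroup.quadraticBasis` (the basis `{1, δ}`), `not_mem_range_algebraMap_of_apply_eq_neg` (`c δ = −δ ≠ 0 ⇒ δ ∉ F`)
import Mathlib.MeasureTheory.Measure.Haar.Unique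
import HarnessLib

/-!
# h413 ∕ Track B «K2-LIT», «R7₃-SCALAR» — `K2E1FiniteAdeleBasisTransport` («ADELIC-BASIS-TRANSPORT»): along a `K`-basis `(b_i)` of `L`,
# `a ↦ Σ_i (a_i)_{𝔸_{L,f}}·(b_i)_{𝔸_{L,f}}` is a homeomorphic group isomorphism `(𝔸_{K,f})^ι ≃ 𝔸_{L,f}`, carries Haar to Haar, and reads `(Σ_i ι_w(a_{i,v})·b_i)_w` at `w ∣ v`

Cell `pub/hodgecm-mathlib`, crux H413 = `stmt-HodgeConjecture-24833`, route `HCCMUnconditional`; E1 «R7₃-SCALAR» (q10) FILE 3 (the `N = 3` Euler product of the intertwining scalar;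
owner K2E2-p12 (g5), «= please type it; FILE 3 consumes BY NAME» 08:05:36Z): at a place `v` of `L⁺` split in `L` the `c`-twist couples the two places `w, w̄ ∣ v`, so the finite height
factor on `𝔸_{L,f} × 𝔸_{L⁺,f}` factorises over the places of `L⁺` only AFTER transporting `𝔸_{L,f}` to `(𝔸_{L⁺,f})²` along the basis `{1, δ}` — then ★ `AdelicProductIntegral`
(`(𝔸_{K,f})^ι`, any finite `ι`) applies at `ι = Fin 3`.  THEOREMS ONLY (no `def`, no `instance`, no `notation`, no named-fact hypothesis, no `sorry`; default heartbeats); lane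
`--kind proof --supports stmt-HodgeConjecture-24833 --as helper` (count-neutral).  GENERIC number fields `K ⊆ L` and ANY `K`-basis `b : Module.Basis ι K L`; §4 specialises to
`ι = Fin 2`, `b = {1, δ}` in E1's CM letters.  The transport is ALWAYS spelled out (no `def`):
`T_b a := ∑ i, Literature.NumberTheory.Automorphic.FiniteAdeleRing.baseChange (𝓞 K) K L (𝓞 L) (a i) * algebraMap L (FiniteAdeleRing (𝓞 L) L) (b i)` for `a : ι → FiniteAdeleRing (𝓞 K) K`,
with the TREE's E1-facing embedding ★ `FiniteAdeleRing.baseChange` (`= 𝔸_{K,f} → 𝔸_{L,f}`, `x ↦ x ⊗ 1`; equal to the FLT packet's `mapSemialgHom` and to the packet's scoped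
`algebraMap 𝔸ᶠ[K] 𝔸ᶠ[L]`, ★ `AutomorphicCompat`), so NO scoped instance appears in any statement below.

THE MATHEMATICS (Cassels–Fröhlich Ch. II §14 Lemma (14.2) and its Corollary `V_K^+ = V_k^+ ⊕ … ⊕ V_k^+`; Weil BNT Ch. IV §1; Tate §3.3).  (§2) `𝔸_{K,f} ⊗_K L ≅ 𝔸_{L,f}` as
`𝔸_{K,f}`-algebras (★ `finiteAdeleRingTensorAlgEquiv`, the vendored FLT base-change packet), so the `K`-basis `b` gives an `𝔸_{K,f}`-basis `B_i = (b_i)_{𝔸_{L,f}}` of `𝔸_{L,f}`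
(Mathlib `Algebra.TensorProduct.basis`), i.e. the `𝔸_{K,f}`-linear isomorphism `B.equivFun.symm : (𝔸_{K,f})^ι ≃ 𝔸_{L,f}`, `a ↦ Σ a_i • B_i = T_b a`; both sides carry the
`𝔸_{K,f}`-MODULE TOPOLOGY (★ scoped instance of the packet ∕ Mathlib `IsModuleTopology.instPi`), so it is automatically a HOMEOMORPHISM (★ `IsModuleTopology.continuousLinearEquiv`)
— the finite-adele, chosen-basis twin of the packet's full-adele `piEquiv`.  (§3) A continuous additive isomorphism of locally compact groups carries Haar measure to Haar
measure (Mathlib `ContinuousAddEquiv.isAddHaarMeasure_map`), hence `T_b_* μ = c • ν` with `c = addHaarScalarFactor > 0` for any Haar `μ` on `(𝔸_{K,f})^ι` and `ν` on `𝔸_{L,f}`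
(Mathlib `isAddLeftInvariant_eq_smul`; `𝔸_{L,f}` locally compact second countable ★), and ONE such `c` gives `∫ f(T_b a) dμ(a) = c·∫ f dν` for every `f` with the matching
integrability transfer.  (§1) PLACE BY
PLACE (`w ∣ v`, `v = w ∩ 𝓞 K`): `(T_b a)_w = Σ_i ι_w(a_{i,v})·b_i` with `ι_w : K_v → L_w` the tree's ★ `adicCompletionOfUnder` — the `w`-component depends on the `v`-components
of `a` only, which is what makes the transported height factor a local factor on `K_v^ι`.  (§4) CM LETTERS: for a quadratic `E ∕ F` (`Algebra.IsQuadraticExtension F E`) and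
`δ ∈ E` with `c δ = −δ ≠ 0` for an `F`-automorphism `c` (so `δ ∉ F`, ★ `UnitaryGroup.not_mem_range_algebraMap_of_apply_eq_neg`), `{1, δ}` is an `F`-basis
(★ `UnitaryGroup.quadraticBasis`) and `(a, b) ↦ (a)_{𝔸_{E,f}} + (b)_{𝔸_{E,f}}·δ` is the transport, with
`w`-component `ι_w(a_v) + ι_w(b_v)·δ`.  NOT HERE (FILE 2(b)'s, K2E2-p12 (g5)): the local Jacobians (`|δ_w − δ_{w̄}|_v` at split `v`, the integral-basis index at inert `v`).

* §1 `baseChange_mul_algebraMap_apply`, **`basisTransport_apply`** (components), `basisTransport_algebraMap` (rational points `(y_i)_i ↦ (Σ y_i b_i)_{𝔸_{L,f}}`), `basisTransport_add`.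
* §2 **`exists_continuousAddEquiv_eq_basisTransport`**, **`isHomeomorph_basisTransport`**, `continuous_basisTransport`, `bijective_basisTransport`, `injective_∕surjective_`.
* §3 **`isAddHaarMeasure_map_basisTransport`**, **`exists_pos_map_basisTransport_eq_smul`** (`(T_b)_*μ = c • ν`, `0 < c`, `μ(T_b⁻¹ s) = c·ν s`),
  **`exists_pos_integral_comp_basisTransport`** (ONE `c > 0`: `∫ f ∘ T_b dμ = c·∫ f dν` for all `f` + `L¹` transfer), `integrable_comp_basisTransport_iff`.
* §4 (over ★ `UnitaryGroup.quadraticBasis` = `{1, δ}`, ★ `not_mem_range_algebraMap_of_apply_eq_neg`): `quadraticBasis_zero_and_one`, `basisTransport_fin_two_eq`,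
  **`exists_continuousAddEquiv_one_delta`**, `one_delta_transport_apply`, **`exists_pos_integral_comp_one_delta`** (the CM change-of-variables package).
HONEST LABEL.  Count-neutral helper; proves no printed statement; HC_CM is proved only modulo the 7 printed citations (2 remaining named inputs: hLiu418 =
`stmt-HodgeConjecture-24832`, h413 = `stmt-HodgeConjecture-24833`) until rung 0 closes.

## References
* [CasselsFrohlichANT1967] J. W. S. Cassels, *Global fields*, in Cassels–Fröhlich (1967), Ch. II §14 Lemma (14.2) and Corollary (`V_k ⊗_k K = V_K` algebraically and topologically;
  `V_K^+ = ⊕ V_k^+`), §19 (19.4) (a `k`-basis of `K` is a `V_k`-basis of `V_K`).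
* [FLTProject2025] K. Buzzard, R. Taylor et al., *FLT* (Lean 4), `FLT/DedekindDomain/FiniteAdeleRing/BaseChange.lean`, `FLT/NumberField/AdeleRing.lean` (`piEquiv`) — vendored ★.
* [WeilBNT1967] A. Weil, *Basic Number Theory* (1967), Ch. IV §1; [TateThesis1967] J. Tate, in Cassels–Fröhlich Ch. XV, §3.3 (Haar measure on restricted products).
-/

set_option autoImplicit false
set_option linter.dupNamespace false  -- the mandated namespace repeats the summit's segment (`HodgeConjecture.HodgeConjecture`)

noncomputable section

open IsDedekindDomain IsDedekindDomain.HeightOneSpectrum NumberField MeasureTheory Topology Filter Set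
open scoped TensorProduct NumberField.AdeleRing IsDedekindDomain ENNReal NNReal
open Literature.NumberTheory.Automorphic (FiniteAdeleRing.baseChange FiniteAdeleRing.baseChange_apply FiniteAdeleRing.baseChange_algebraMap adicCompletionOfUnder
  secondCountableTopology_finiteAdeleRing locallyCompactSpace_finiteAdeleRing')
open Literature.NumberTheory.AdelicBaseChange (finiteAdeleRingTensorAlgEquiv finiteAdeleRingTensorAlgEquiv_one_tmul finiteAdeleRing_mapSemialgHom_apply_eq_baseChange)

namespace Summit.HodgeConjecture.HodgeConjecture.Cruxes.H413.K2E1FiniteAdeleBasisTransport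

variable (K L : Type) [Field K] [NumberField K] [Field L] [NumberField L] [Algebra K L]
variable {ι : Type} [Fintype ι]

/-! ## §1 Components and rational points of the transport `T_b a = Σ_i (a_i)_{𝔸_{L,f}} · (b_i)_{𝔸_{L,f}}` -/

/-- One term, place by place: `((a)_{𝔸_{L,f}} · (l)_{𝔸_{L,f}})_w = ι_w(a_v) · l` in `L_w` for `w ∣ v` (`v = w.under (𝓞 K)`; ★ `FiniteAdeleRing.baseChange_apply`, Mathlib
`FiniteAdeleRing.algebraMap_apply`). [cite: CasselsFrohlichANT1967, Ch. II §14] -/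
theorem baseChange_mul_algebraMap_apply (a : FiniteAdeleRing (𝓞 K) K) (l : L) (w : HeightOneSpectrum (𝓞 L)) :
    (FiniteAdeleRing.baseChange (𝓞 K) K L (𝓞 L) a * algebraMap L (FiniteAdeleRing (𝓞 L) L) l) w =
      adicCompletionOfUnder (𝓞 K) K L w (a (w.under (𝓞 K))) * (l : w.adicCompletion L) := by
  rw [show (FiniteAdeleRing.baseChange (𝓞 K) K L (𝓞 L) a * algebraMap L (FiniteAdeleRing (𝓞 L) L) l) w =
      FiniteAdeleRing.baseChange (𝓞 K) K L (𝓞 L) a w * algebraMap L (FiniteAdeleRing (𝓞 L) L) l w from rfl,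
    FiniteAdeleRing.baseChange_apply, IsDedekindDomain.FiniteAdeleRing.algebraMap_apply]

/-- **COMPONENTS OF THE TRANSPORT** (`w ∣ v`): `(T_b a)_w = Σ_i ι_w(a_{i,v}) · b_i` — the `w`-component depends on the `v`-components `(a_{i,v})_i ∈ K_v^ι` only.
[cite: CasselsFrohlichANT1967, Ch. II §14 Corollary to Lemma (14.2)] -/
theorem basisTransport_apply (b : Module.Basis ι K L) (a : ι → FiniteAdeleRing (𝓞 K) K) (w : HeightOneSpectrum (𝓞 L)) :
    (∑ i, FiniteAdeleRing.baseChange (𝓞 K) K L (𝓞 L) (a i) * algebraMap L (FiniteAdeleRing (𝓞 L) L) (b i)) w =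
      ∑ i, adicCompletionOfUnder (𝓞 K) K L w (a i (w.under (𝓞 K))) * (b i : w.adicCompletion L) := by
  classical
  have hsum : ∀ (s : Finset ι) (f : ι → FiniteAdeleRing (𝓞 L) L), (∑ i ∈ s, f i) w = ∑ i ∈ s, f i w := by
    intro s f
    induction s using Finset.induction_on with
    | empty => rw [Finset.sum_empty, Finset.sum_empty]; rfl
    | insert i s hi ih => rw [Finset.sum_insert hi, Finset.sum_insert hi, ← ih]; rfl
  rw [hsum]
  exact Finset.sum_congr rfl fun i _ => baseChange_mul_algebraMap_apply K L (a i) (b i) w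

/-- **RATIONAL POINTS**: on principal vectors the transport is the principal adele of the same `K`-combination, `T_b((y_i)_{𝔸_{K,f}}) = (Σ_i y_i b_i)_{𝔸_{L,f}}`
(★ `FiniteAdeleRing.baseChange_algebraMap`). [cite: CasselsFrohlichANT1967, Ch. II §14 Corollary to Lemma (14.2)] -/
theorem basisTransport_algebraMap (b : Module.Basis ι K L) (y : ι → K) :
    (∑ i, FiniteAdeleRing.baseChange (𝓞 K) K L (𝓞 L) (algebraMap K (FiniteAdeleRing (𝓞 K) K) (y i)) * algebraMap L (FiniteAdeleRing (𝓞 L) L) (b i)) =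
      algebraMap L (FiniteAdeleRing (𝓞 L) L) (∑ i, y i • b i) := by
  rw [map_sum]
  refine Finset.sum_congr rfl fun i _ => ?_
  rw [FiniteAdeleRing.baseChange_algebraMap, ← map_mul, Algebra.smul_def]

/-- The transport is additive (it is `𝔸_{K,f}`-linear; only additivity is recorded in instance-free letters). [cite: CasselsFrohlichANT1967, Ch. II §14] -/
theorem basisTransport_add (b : Module.Basis ι K L) (a a' : ι → FiniteAdeleRing (𝓞 K) K) :
    (∑ i, FiniteAdeleRing.baseChange (𝓞 K) K L (𝓞 L) ((a + a') i) * algebraMap L (FiniteAdeleRing (𝓞 L) L) (b i)) =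
      (∑ i, FiniteAdeleRing.baseChange (𝓞 K) K L (𝓞 L) (a i) * algebraMap L (FiniteAdeleRing (𝓞 L) L) (b i)) +
        ∑ i, FiniteAdeleRing.baseChange (𝓞 K) K L (𝓞 L) (a' i) * algebraMap L (FiniteAdeleRing (𝓞 L) L) (b i) := by
  rw [← Finset.sum_add_distrib]
  refine Finset.sum_congr rfl fun i _ => ?_
  rw [Pi.add_apply, map_add, add_mul]

/-! ## §2 THE TRANSPORT IS A HOMEOMORPHIC GROUP ISOMORPHISM `(𝔸_{K,f})^ι ≃ₜ+ 𝔸_{L,f}` -/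

/-- **`V_L,f^+ = ⊕_i V_{K,f}^+` ALONG A CHOSEN BASIS** (Cassels–Fröhlich II §14, Corollary to Lemma (14.2), finite part): there is a homeomorphic additive isomorphism
`e : (𝔸_{K,f})^ι ≃ₜ+ 𝔸_{L,f}` with `e a = Σ_i (a_i)_{𝔸_{L,f}}·(b_i)_{𝔸_{L,f}}` — the `𝔸_{K,f}`-basis `(b_i)_{𝔸_{L,f}}` of ★ `finiteAdeleRingTensorAlgEquiv` (Mathlib `Algebra.TensorProduct.basis`),
continuous both ways because both sides carry the `𝔸_{K,f}`-module topology (★ `IsModuleTopology.continuousLinearEquiv`).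
[cite: CasselsFrohlichANT1967, Ch. II §14 Corollary to Lemma (14.2)] [cite: FLTProject2025, FLT/NumberField/AdeleRing.lean · NumberField.AdeleRing.piEquiv] -/
theorem exists_continuousAddEquiv_eq_basisTransport (b : Module.Basis ι K L) :
    ∃ e : (ι → FiniteAdeleRing (𝓞 K) K) ≃ₜ+ FiniteAdeleRing (𝓞 L) L,
      ∀ a, e a = ∑ i, FiniteAdeleRing.baseChange (𝓞 K) K L (𝓞 L) (a i) * algebraMap L (FiniteAdeleRing (𝓞 L) L) (b i) := by
  classical
  let B : Module.Basis ι (FiniteAdeleRing (𝓞 K) K) (FiniteAdeleRing (𝓞 L) L) :=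
    (Algebra.TensorProduct.basis (FiniteAdeleRing (𝓞 K) K) b).map (finiteAdeleRingTensorAlgEquiv K L).toLinearEquiv
  have hB : ∀ i, B i = algebraMap L (FiniteAdeleRing (𝓞 L) L) (b i) := fun i => by
    simp only [B, Module.Basis.map_apply, Algebra.TensorProduct.basis_apply, AlgEquiv.toLinearEquiv_apply, finiteAdeleRingTensorAlgEquiv_one_tmul]
  let e : (ι → FiniteAdeleRing (𝓞 K) K) ≃L[FiniteAdeleRing (𝓞 K) K] FiniteAdeleRing (𝓞 L) L :=
    IsModuleTopology.continuousLinearEquiv B.equivFun.symm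
  refine ⟨e.toContinuousAddEquiv, fun a => ?_⟩
  change B.equivFun.symm a = _
  rw [Module.Basis.equivFun_symm_apply]
  refine Finset.sum_congr rfl fun i _ => ?_
  rw [hB, Algebra.smul_def]
  exact congrArg (· * _) (finiteAdeleRing_mapSemialgHom_apply_eq_baseChange (A := 𝓞 K) (B := 𝓞 L) K L (a i))

/-- **The transport `T_b` is a homeomorphism** `(𝔸_{K,f})^ι → 𝔸_{L,f}`. [cite: CasselsFrohlichANT1967, Ch. II §14 Corollary to Lemma (14.2)] -/
theorem isHomeomorph_basisTransport (b : Module.Basis ι K L) :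
    IsHomeomorph fun a : ι → FiniteAdeleRing (𝓞 K) K => ∑ i, FiniteAdeleRing.baseChange (𝓞 K) K L (𝓞 L) (a i) * algebraMap L (FiniteAdeleRing (𝓞 L) L) (b i) := by
  obtain ⟨e, he⟩ := exists_continuousAddEquiv_eq_basisTransport K L b
  have h : (fun a : ι → FiniteAdeleRing (𝓞 K) K => ∑ i, FiniteAdeleRing.baseChange (𝓞 K) K L (𝓞 L) (a i) * algebraMap L (FiniteAdeleRing (𝓞 L) L) (b i)) = e :=
    funext fun a => (he a).symm
  rw [h]
  exact e.toHomeomorph.isHomeomorph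

/-- `T_b` is continuous. [cite: CasselsFrohlichANT1967, Ch. II §14] -/
theorem continuous_basisTransport (b : Module.Basis ι K L) :
    Continuous fun a : ι → FiniteAdeleRing (𝓞 K) K => ∑ i, FiniteAdeleRing.baseChange (𝓞 K) K L (𝓞 L) (a i) * algebraMap L (FiniteAdeleRing (𝓞 L) L) (b i) :=
  (isHomeomorph_basisTransport K L b).continuous

/-- `T_b` is bijective. [cite: CasselsFrohlichANT1967, Ch. II §14 Corollary to Lemma (14.2)] -/
theorem bijective_basisTransport (b : Module.Basis ι K L) :
    Function.Bijective fun a : ι → FiniteAdeleRing (𝓞 K) K => ∑ i, FiniteAdeleRing.baseChange (𝓞 K) K L (𝓞 L) (a i) * algebraMap L (FiniteAdeleRing (𝓞 L) L) (b i) :=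
  (isHomeomorph_basisTransport K L b).bijective

/-- `T_b` is injective: an adele of `L` has UNIQUE coordinates along `b`. [cite: CasselsFrohlichANT1967, Ch. II §19 (19.4)] -/
theorem injective_basisTransport (b : Module.Basis ι K L) :
    Function.Injective fun a : ι → FiniteAdeleRing (𝓞 K) K => ∑ i, FiniteAdeleRing.baseChange (𝓞 K) K L (𝓞 L) (a i) * algebraMap L (FiniteAdeleRing (𝓞 L) L) (b i) :=
  (bijective_basisTransport K L b).1

/-- `T_b` is surjective: every finite adele of `L` is `Σ_i (a_i)_{𝔸_{L,f}}·b_i`. [cite: CasselsFrohlichANT1967, Ch. II §19 (19.4)] -/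
theorem surjective_basisTransport (b : Module.Basis ι K L) :
    Function.Surjective fun a : ι → FiniteAdeleRing (𝓞 K) K => ∑ i, FiniteAdeleRing.baseChange (𝓞 K) K L (𝓞 L) (a i) * algebraMap L (FiniteAdeleRing (𝓞 L) L) (b i) :=
  (bijective_basisTransport K L b).2

/-! ## §3 HAAR MEASURE: `T_b` carries Haar to Haar; `(T_b)_* μ = c • ν`; `∫ f ∘ T_b dμ = c · ∫ f dν` -/

section Haar

variable [MeasurableSpace (FiniteAdeleRing (𝓞 K) K)] [BorelSpace (FiniteAdeleRing (𝓞 K) K)]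
  [MeasurableSpace (FiniteAdeleRing (𝓞 L) L)] [BorelSpace (FiniteAdeleRing (𝓞 L) L)]

/-- **The push-forward of a Haar measure of `(𝔸_{K,f})^ι` under `T_b` is a Haar measure of `𝔸_{L,f}`** (Mathlib `ContinuousAddEquiv.isAddHaarMeasure_map`; the Borel structure
of the product uses ★ `secondCountableTopology_finiteAdeleRing`). [cite: WeilBNT1967, Ch. IV §1] [cite: CasselsFrohlichANT1967, Ch. II §14] -/
theorem isAddHaarMeasure_map_basisTransport (b : Module.Basis ι K L) (μ : Measure (ι → FiniteAdeleRing (𝓞 K) K)) [μ.IsAddHaarMeasure] :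
    (μ.map fun a : ι → FiniteAdeleRing (𝓞 K) K => ∑ i, FiniteAdeleRing.baseChange (𝓞 K) K L (𝓞 L) (a i) * algebraMap L (FiniteAdeleRing (𝓞 L) L) (b i)).IsAddHaarMeasure := by
  haveI : SecondCountableTopology (FiniteAdeleRing (𝓞 K) K) := secondCountableTopology_finiteAdeleRing K
  obtain ⟨e, he⟩ := exists_continuousAddEquiv_eq_basisTransport K L b
  have h : (fun a : ι → FiniteAdeleRing (𝓞 K) K => ∑ i, FiniteAdeleRing.baseChange (𝓞 K) K L (𝓞 L) (a i) * algebraMap L (FiniteAdeleRing (𝓞 L) L) (b i)) = e :=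
    funext fun a => (he a).symm
  rw [h]
  exact e.isAddHaarMeasure_map μ

/-- **`(T_b)_* μ = c • ν` with `0 < c < ∞`** for every Haar `μ` on `(𝔸_{K,f})^ι` and `ν` on `𝔸_{L,f}` (Haar uniqueness on the locally compact second countable `𝔸_{L,f}` ★;
Mathlib `isAddLeftInvariant_eq_smul`, `addHaarScalarFactor_pos_of_isAddHaarMeasure`), together with the set-wise reading `μ(T_b⁻¹ s) = c·ν(s)` for EVERY `s` (so `c` is computable
from any convenient box). [cite: WeilBNT1967, Ch. IV §1] [cite: TateThesis1967, §3.3] -/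
theorem exists_pos_map_basisTransport_eq_smul (b : Module.Basis ι K L) (μ : Measure (ι → FiniteAdeleRing (𝓞 K) K)) [μ.IsAddHaarMeasure]
    (ν : Measure (FiniteAdeleRing (𝓞 L) L)) [ν.IsAddHaarMeasure] :
    ∃ c : ℝ≥0, 0 < c ∧
      (μ.map fun a : ι → FiniteAdeleRing (𝓞 K) K => ∑ i, FiniteAdeleRing.baseChange (𝓞 K) K L (𝓞 L) (a i) * algebraMap L (FiniteAdeleRing (𝓞 L) L) (b i)) = c • ν ∧
      ∀ s : Set (FiniteAdeleRing (𝓞 L) L),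
        μ ((fun a : ι → FiniteAdeleRing (𝓞 K) K => ∑ i, FiniteAdeleRing.baseChange (𝓞 K) K L (𝓞 L) (a i) * algebraMap L (FiniteAdeleRing (𝓞 L) L) (b i)) ⁻¹' s) = c * ν s := by
  haveI : SecondCountableTopology (FiniteAdeleRing (𝓞 K) K) := secondCountableTopology_finiteAdeleRing K
  haveI : SecondCountableTopology (FiniteAdeleRing (𝓞 L) L) := secondCountableTopology_finiteAdeleRing L
  haveI : LocallyCompactSpace (FiniteAdeleRing (𝓞 L) L) := locallyCompactSpace_finiteAdeleRing' L
  obtain ⟨e, he⟩ := exists_continuousAddEquiv_eq_basisTransport K L b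
  have h : (fun a : ι → FiniteAdeleRing (𝓞 K) K => ∑ i, FiniteAdeleRing.baseChange (𝓞 K) K L (𝓞 L) (a i) * algebraMap L (FiniteAdeleRing (𝓞 L) L) (b i)) = e :=
    funext fun a => (he a).symm
  rw [h]
  haveI : (μ.map e).IsAddHaarMeasure := e.isAddHaarMeasure_map μ
  have heq : μ.map e = Measure.addHaarScalarFactor (μ.map e) ν • ν := Measure.isAddLeftInvariant_eq_smul _ ν
  refine ⟨Measure.addHaarScalarFactor (μ.map e) ν, Measure.addHaarScalarFactor_pos_of_isAddHaarMeasure _ ν, heq, fun s => ?_⟩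
  have hmap : μ (e ⁻¹' s) = μ.map e s := (e.toHomeomorph.toMeasurableEquiv.map_apply s).symm
  have h2 := congrArg (fun m : Measure (FiniteAdeleRing (𝓞 L) L) => m s) heq
  simp only [Measure.coe_nnreal_smul_apply] at h2
  rw [hmap, h2]

/-- **CHANGE OF VARIABLES PACKAGE**: ONE constant `c > 0` with `∫ f(T_b a) dμ(a) = c·∫ f dν` for EVERY `f`, and `f ∘ T_b ∈ L¹(μ) ↔ f ∈ L¹(ν)` — for any Haar `μ` on `(𝔸_{K,f})^ι`
and `ν` on `𝔸_{L,f}` (Mathlib `integral_map_equiv`∕`integrable_map_equiv` along the homeomorphism, then `(T_b)_* μ = c • ν`). [cite: WeilBNT1967, Ch. IV §1] [cite: TateThesis1967, §3.3] -/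
theorem exists_pos_integral_comp_basisTransport {G : Type*} [NormedAddCommGroup G] [NormedSpace ℝ G] (b : Module.Basis ι K L)
    (μ : Measure (ι → FiniteAdeleRing (𝓞 K) K)) [μ.IsAddHaarMeasure] (ν : Measure (FiniteAdeleRing (𝓞 L) L)) [ν.IsAddHaarMeasure] :
    ∃ c : ℝ≥0, 0 < c ∧
      (∀ f : FiniteAdeleRing (𝓞 L) L → G,
        ∫ a, f (∑ i, FiniteAdeleRing.baseChange (𝓞 K) K L (𝓞 L) (a i) * algebraMap L (FiniteAdeleRing (𝓞 L) L) (b i)) ∂μ = (c : ℝ) • ∫ x, f x ∂ν) ∧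
      ∀ f : FiniteAdeleRing (𝓞 L) L → G,
        Integrable (fun a => f (∑ i, FiniteAdeleRing.baseChange (𝓞 K) K L (𝓞 L) (a i) * algebraMap L (FiniteAdeleRing (𝓞 L) L) (b i))) μ ↔ Integrable f ν := by
  haveI : SecondCountableTopology (FiniteAdeleRing (𝓞 K) K) := secondCountableTopology_finiteAdeleRing K
  obtain ⟨c, hc0, hc, -⟩ := exists_pos_map_basisTransport_eq_smul K L b μ ν
  obtain ⟨e, he⟩ := exists_continuousAddEquiv_eq_basisTransport K L b
  have h : (fun a : ι → FiniteAdeleRing (𝓞 K) K => ∑ i, FiniteAdeleRing.baseChange (𝓞 K) K L (𝓞 L) (a i) * algebraMap L (FiniteAdeleRing (𝓞 L) L) (b i)) = e :=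
    funext fun a => (he a).symm
  rw [h] at hc
  refine ⟨c, hc0, fun f => ?_, fun f => ?_⟩
  · have h1 : ∫ a, f (e a) ∂μ = ∫ x, f x ∂(μ.map e) := (integral_map_equiv e.toHomeomorph.toMeasurableEquiv f).symm
    have h2 : (fun a : ι → FiniteAdeleRing (𝓞 K) K => f (∑ i, FiniteAdeleRing.baseChange (𝓞 K) K L (𝓞 L) (a i) * algebraMap L (FiniteAdeleRing (𝓞 L) L) (b i))) =
        fun a => f (e a) := funext fun a => by rw [he a]
    rw [h2, h1, hc, integral_smul_nnreal_measure, NNReal.smul_def]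
  · have h1 : Integrable (fun a => f (e a)) μ ↔ Integrable f (μ.map e) := (integrable_map_equiv e.toHomeomorph.toMeasurableEquiv f).symm
    have h2 : (fun a : ι → FiniteAdeleRing (𝓞 K) K => f (∑ i, FiniteAdeleRing.baseChange (𝓞 K) K L (𝓞 L) (a i) * algebraMap L (FiniteAdeleRing (𝓞 L) L) (b i))) =
        fun a => f (e a) := funext fun a => by rw [he a]
    rw [h2, h1, hc, ENNReal.smul_def, integrable_smul_measure (by exact_mod_cast hc0.ne') ENNReal.coe_ne_top]

/-- **INTEGRABILITY TRANSFER** alone: `f ∘ T_b ∈ L¹(μ) ↔ f ∈ L¹(ν)`. [cite: WeilBNT1967, Ch. IV §1] -/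
theorem integrable_comp_basisTransport_iff {G : Type*} [NormedAddCommGroup G] (b : Module.Basis ι K L)
    (μ : Measure (ι → FiniteAdeleRing (𝓞 K) K)) [μ.IsAddHaarMeasure] (ν : Measure (FiniteAdeleRing (𝓞 L) L)) [ν.IsAddHaarMeasure] (f : FiniteAdeleRing (𝓞 L) L → G) :
    Integrable (fun a => f (∑ i, FiniteAdeleRing.baseChange (𝓞 K) K L (𝓞 L) (a i) * algebraMap L (FiniteAdeleRing (𝓞 L) L) (b i))) μ ↔ Integrable f ν := by
  haveI : SecondCountableTopology (FiniteAdeleRing (𝓞 K) K) := secondCountableTopology_finiteAdeleRing K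
  obtain ⟨c, hc0, hc, -⟩ := exists_pos_map_basisTransport_eq_smul K L b μ ν
  obtain ⟨e, he⟩ := exists_continuousAddEquiv_eq_basisTransport K L b
  have h : (fun a : ι → FiniteAdeleRing (𝓞 K) K => ∑ i, FiniteAdeleRing.baseChange (𝓞 K) K L (𝓞 L) (a i) * algebraMap L (FiniteAdeleRing (𝓞 L) L) (b i)) = e :=
    funext fun a => (he a).symm
  rw [h] at hc
  have h1 : Integrable (fun a => f (e a)) μ ↔ Integrable f (μ.map e) := (integrable_map_equiv e.toHomeomorph.toMeasurableEquiv f).symm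
  have h2 : (fun a : ι → FiniteAdeleRing (𝓞 K) K => f (∑ i, FiniteAdeleRing.baseChange (𝓞 K) K L (𝓞 L) (a i) * algebraMap L (FiniteAdeleRing (𝓞 L) L) (b i))) =
      fun a => f (e a) := funext fun a => by rw [he a]
  rw [h2, h1, hc, ENNReal.smul_def, integrable_smul_measure (by exact_mod_cast hc0.ne') ENNReal.coe_ne_top]

end Haar

/-! ## §4 CM letters: the basis `{1, δ}` of a quadratic `E ∕ F` with `c δ = −δ ≠ 0`, and the transport `(a, b) ↦ (a)_{𝔸_{E,f}} + (b)_{𝔸_{E,f}}·δ` -/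

section CM

variable {F E : Type} [Field F] [NumberField F] [Field E] [NumberField E] [Algebra F E]

/-- For `b = {1, δ}` — the tree's ★ `UnitaryGroup.quadraticBasis E hδF` (`δ ∉ F`; `UnitaryGroupSymplecticCarriers`) — the two basis values. [folklore] -/
theorem quadraticBasis_zero_and_one [Algebra.IsQuadraticExtension F E] {δ : E} (hδF : δ ∉ Set.range (algebraMap F E)) :
    Literature.NumberTheory.Automorphic.UnitaryGroup.quadraticBasis E hδF 0 = 1 ∧ Literature.NumberTheory.Automorphic.UnitaryGroup.quadraticBasis E hδF 1 = δ := by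
  rw [Literature.NumberTheory.Automorphic.UnitaryGroup.coe_quadraticBasis]
  exact ⟨rfl, rfl⟩

/-- Along `b = {1, δ}` the transport reads `(a₀, a₁) ↦ (a₀)_{𝔸_{E,f}} + (a₁)_{𝔸_{E,f}}·(δ)_{𝔸_{E,f}}`. [cite: CasselsFrohlichANT1967, Ch. II §14] -/
theorem basisTransport_fin_two_eq {b : Module.Basis (Fin 2) F E} {δ : E} (hb0 : b 0 = 1) (hb1 : b 1 = δ) (a : Fin 2 → FiniteAdeleRing (𝓞 F) F) :
    (∑ i, FiniteAdeleRing.baseChange (𝓞 F) F E (𝓞 E) (a i) * algebraMap E (FiniteAdeleRing (𝓞 E) E) (b i)) =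
      FiniteAdeleRing.baseChange (𝓞 F) F E (𝓞 E) (a 0) + FiniteAdeleRing.baseChange (𝓞 F) F E (𝓞 E) (a 1) * algebraMap E (FiniteAdeleRing (𝓞 E) E) δ := by
  rw [Fin.sum_univ_two, hb0, hb1, map_one, mul_one]

/-- **THE CM TRANSPORT** `(a₀, a₁) ↦ (a₀)_{𝔸_{E,f}} + (a₁)_{𝔸_{E,f}}·δ` is a homeomorphic additive isomorphism `(𝔸_{F,f})² ≃ₜ+ 𝔸_{E,f}` whenever `c δ = −δ ≠ 0` for an
`F`-automorphism `c` of the quadratic extension `E ∕ F` (E1's letters `hcδ`, `hδ`). [cite: CasselsFrohlichANT1967, Ch. II §14 Corollary to Lemma (14.2)] -/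
theorem exists_continuousAddEquiv_one_delta [Algebra.IsQuadraticExtension F E] (c : E ≃ₐ[F] E) {δ : E} (hcδ : c δ = -δ) (hδ : δ ≠ 0) :
    ∃ e : (Fin 2 → FiniteAdeleRing (𝓞 F) F) ≃ₜ+ FiniteAdeleRing (𝓞 E) E,
      ∀ a, e a = FiniteAdeleRing.baseChange (𝓞 F) F E (𝓞 E) (a 0) + FiniteAdeleRing.baseChange (𝓞 F) F E (𝓞 E) (a 1) * algebraMap E (FiniteAdeleRing (𝓞 E) E) δ := by
  obtain ⟨hb0, hb1⟩ := quadraticBasis_zero_and_one (Literature.NumberTheory.Automorphic.UnitaryGroup.not_mem_range_algebraMap_of_apply_eq_neg E c hcδ hδ)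
  obtain ⟨e, he⟩ := exists_continuousAddEquiv_eq_basisTransport F E
    (Literature.NumberTheory.Automorphic.UnitaryGroup.quadraticBasis E (Literature.NumberTheory.Automorphic.UnitaryGroup.not_mem_range_algebraMap_of_apply_eq_neg E c hcδ hδ))
  exact ⟨e, fun a => by rw [he, basisTransport_fin_two_eq hb0 hb1]⟩

/-- Components of the CM transport (`w ∣ v`, `v = w.under (𝓞 F)`): `((a₀)_{𝔸_{E,f}} + (a₁)_{𝔸_{E,f}}·δ)_w = ι_w(a_{0,v}) + ι_w(a_{1,v})·δ`. [cite: CasselsFrohlichANT1967, Ch. II §14] -/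
theorem one_delta_transport_apply (δ : E) (a : Fin 2 → FiniteAdeleRing (𝓞 F) F) (w : HeightOneSpectrum (𝓞 E)) :
    (FiniteAdeleRing.baseChange (𝓞 F) F E (𝓞 E) (a 0) + FiniteAdeleRing.baseChange (𝓞 F) F E (𝓞 E) (a 1) * algebraMap E (FiniteAdeleRing (𝓞 E) E) δ) w =
      adicCompletionOfUnder (𝓞 F) F E w (a 0 (w.under (𝓞 F))) + adicCompletionOfUnder (𝓞 F) F E w (a 1 (w.under (𝓞 F))) * (δ : w.adicCompletion E) := by
  rw [show (FiniteAdeleRing.baseChange (𝓞 F) F E (𝓞 E) (a 0) + FiniteAdeleRing.baseChange (𝓞 F) F E (𝓞 E) (a 1) * algebraMap E (FiniteAdeleRing (𝓞 E) E) δ) w =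
      FiniteAdeleRing.baseChange (𝓞 F) F E (𝓞 E) (a 0) w + (FiniteAdeleRing.baseChange (𝓞 F) F E (𝓞 E) (a 1) * algebraMap E (FiniteAdeleRing (𝓞 E) E) δ) w from rfl,
    FiniteAdeleRing.baseChange_apply, baseChange_mul_algebraMap_apply]

/-- **THE CM CHANGE OF VARIABLES PACKAGE** for FILE 3: one constant `c > 0` with `∫ f((a₀)_𝔸 + (a₁)_𝔸·δ) dμ(a) = c·∫ f dν` for EVERY `f`, and the integrability transfer, for any
Haar `μ` on `(𝔸_{F,f})²` and `ν` on `𝔸_{E,f}`. [cite: WeilBNT1967, Ch. IV §1] [cite: TateThesis1967, §3.3] -/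
theorem exists_pos_integral_comp_one_delta [Algebra.IsQuadraticExtension F E] (c : E ≃ₐ[F] E) {δ : E} (hcδ : c δ = -δ) (hδ : δ ≠ 0)
    [MeasurableSpace (FiniteAdeleRing (𝓞 F) F)] [BorelSpace (FiniteAdeleRing (𝓞 F) F)] [MeasurableSpace (FiniteAdeleRing (𝓞 E) E)] [BorelSpace (FiniteAdeleRing (𝓞 E) E)]
    (μ : Measure (Fin 2 → FiniteAdeleRing (𝓞 F) F)) [μ.IsAddHaarMeasure] (ν : Measure (FiniteAdeleRing (𝓞 E) E)) [ν.IsAddHaarMeasure]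
    {G : Type*} [NormedAddCommGroup G] [NormedSpace ℝ G] :
    ∃ C : ℝ≥0, 0 < C ∧
      (∀ f : FiniteAdeleRing (𝓞 E) E → G,
        ∫ a, f (FiniteAdeleRing.baseChange (𝓞 F) F E (𝓞 E) (a 0) + FiniteAdeleRing.baseChange (𝓞 F) F E (𝓞 E) (a 1) * algebraMap E (FiniteAdeleRing (𝓞 E) E) δ) ∂μ = (C : ℝ) • ∫ x, f x ∂ν) ∧
      ∀ f : FiniteAdeleRing (𝓞 E) E → G,
        Integrable (fun a => f (FiniteAdeleRing.baseChange (𝓞 F) F E (𝓞 E) (a 0) + FiniteAdeleRing.baseChange (𝓞 F) F E (𝓞 E) (a 1) * algebraMap E (FiniteAdeleRing (𝓞 E) E) δ)) μ ↔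
          Integrable f ν := by
  obtain ⟨hb0, hb1⟩ := quadraticBasis_zero_and_one (Literature.NumberTheory.Automorphic.UnitaryGroup.not_mem_range_algebraMap_of_apply_eq_neg E c hcδ hδ)
  obtain ⟨C, hC0, hint, hL1⟩ := exists_pos_integral_comp_basisTransport (G := G) F E
    (Literature.NumberTheory.Automorphic.UnitaryGroup.quadraticBasis E (Literature.NumberTheory.Automorphic.UnitaryGroup.not_mem_range_algebraMap_of_apply_eq_neg E c hcδ hδ)) μ ν
  refine ⟨C, hC0, fun f => ?_, fun f => ?_⟩
  · simp only [← basisTransport_fin_two_eq hb0 hb1]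
    exact hint f
  · simp only [← basisTransport_fin_two_eq hb0 hb1]
    exact hL1 f

end CM

end Summit.HodgeConjecture.HodgeConjecture.Cruxes.H413.K2E1FiniteAdeleBasisTransport

end
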